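import Summits.BirchSwinnertonDyer.Rank1Residual.GaloisImage.SmallImageNiveauDichotomyGeneral
import Summits.BirchSwinnertonDyer.Rank1Residual.GaloisImage.SupersingularTwistNonsplitCartan
import Summits.BirchSwinnertonDyer.Rank1Residual.O5.GssTwistDictionary
import Literature.NumberTheory.EllipticCurves.SupersingularIrreducibleProofs
import HarnessLib

/-!
# NIVEAU 2 BY THEOREM on the `(G) ∧ ss` rows: a curve with a good SUPERSINGULAR quadratic twist at
# an odd `p` has NO `I_𝔓`-stable line in `E[p]`, at EVERY `𝔓 ∣ p` — O8-TAME part 10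
# (cell `b2b-bsdres`, lane CLASS-CLOSURE, seat cc-typer-1 = typer of record N11 / O8, GEN 9; joint
# small-image axis O8 / N2 / N3; sub-partition key `e_p = #ρ̄_{E,p}(I_𝔓)` of O8/SUBPARTITION-typed)

HONEST FRAMING (cell `b2b-bsdres`, run/shared/lean/b2b/bsd-rank1-residual/, verbatim in every
file): the goal of the cell is to DELETE the COMBINATION-SHAPED residual classes of the
Birch–Swinnerton-Dyer formula for ALL analytic-rank `≤ 1` elliptic curves over `ℚ` — "full BSD
formula for every rank `≤ 1` curve in class `C`" assembled STRICTLY from published theorems — so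
that the rank-`≤ 1` remainder becomes exactly the CONSTRUCTION-SHAPED classes, which are TYPED
(missing-input `Prop`s), NOT attempted. This is not "finishing BSD". THEOREMS ONLY: no definition,
no named fact, no conjecture node, nothing booked, no label of `RESIDUAL-MAP.md` moved; census
counts quoted below are EVIDENCE, never a Literature fact.

## What this file does

GEN 9's `SmallImageNiveauDichotomyGeneral.lean` proved, at every `p` and every `𝔓 ∣ p`, the
NIVEAU DICHOTOMY on a tame row (`p ∤ e_p`): either `e_p = p − 1` with an `I_𝔓`-stable pair of lines
(niveau 1), or `(p − 1) ∣ e_p ∤ p − 1` with NO `I_𝔓`-stable line (niveau 2). Which side a given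
O8 row falls on was a THEOREM on the (M) and (G-ord) rows (niveau 1: `TwistedOrdinaryLineAt`,
GEN 7–9) but only EVIDENCE on the `(G) ∧ ss` rows (`O8/SUBPARTITION-typed.md` §19: niveau 2 on
232/232 rows at `p ≥ 5`). This file makes it a THEOREM, at every odd `p`:

* §1 (pure transport) `exists_stableLine_of_signed_addEquiv` / `exists_stableLine_iff_of_signed_addEquiv`
  — an additive isomorphism `t : W₁[p] ≃+ W₂[p]` that is `Γ_ℚ`-equivariant UP TO A SIGN depending
  on `σ` (the shape produced by a quadratic twist, *AEC* X.5.4, tree theorem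
  `exists_torsion_addEquiv_signed_of_model_twist` of n1011-p04) carries `H`-stable lines to
  `H`-stable lines for every `H ≤ Γ_ℚ` (a line is closed under `−1`); and
  `exists_stableLine_inertia_smul` / `not_exists_stableLine_of_mem_primesAbove` — an
  `I_𝔓`-stable line gives an `I_{g𝔓}`-stable line (`I_{g𝔓} = g I_𝔓 g⁻¹`), so by the transitivity
  of `Γ_ℚ` on the primes above `p` (`exists_smul_eq_of_mem_primesAbove_holds`) "no `I_𝔓`-stable
  line" at ONE `𝔓 ∣ p` gives it at EVERY `𝔓 ∣ p`.
* §2 **`not_exists_inertia_stableLine_of_goodSS`** — Serre 1972 §1.11 Prop. 12 in LOCAL form: for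
  `W/ℚ` globally minimal, `p` odd, `GoodSS W p` (good reduction, `p ∣ a_p`): `E[p]` has NO
  `I_𝔓`-stable line, at every `𝔓 ∣ p`. (At the place's prime the inertia image is cyclic of
  order `p² − 1` — tree theorem `isCyclic_and_card_inertia_map_of_dvd_frobeniusTrace` with the tame
  Kummer input `exists_mem_inertia_smul_eq_mul_of_pow_eq`; `p ∤ p² − 1` and `p² − 1 ∤ p − 1`, so
  GEN 9's `not_exists_stableLine_iff_not_card_inertia_map_dvd_sub_one` applies; then §1 moves it to
  every `𝔓 ∣ p`.) The tree had only the GLOBAL corollary `hasIrreducibleModPGaloisRep_of_dvd_frobeniusTrace`.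
* §3 **`not_exists_inertia_stableLine_of_goodSS_twist`** — if some `ℚ`-model `Wd` of a quadratic
  twist `E^{(d)}` (`C • W.quadraticTwist d = Wd`, `d ≠ 0`, `Wd` globally minimal) has `GoodSS Wd p`,
  `p` odd, then `E[p]` has no `I_𝔓`-stable line at any `𝔓 ∣ p`; `exists_inertia_stableLine_iff_of_twist`
  — having an `I_𝔓`-stable line is a quadratic-twist invariant (any `d ≠ 0`, any `p`).
* §4 the census cell: **`SubGss.not_exists_inertia_stableLine`** — on `(G) ∧ ss` (cc-typer-5's
  `Additive.SubGss`, `E` additive at an odd `p`; supply theorem `exists_goodSS_twist_pStar_of_subGss`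
  of `O5/GssTwistDictionary.lean`) `E[p]|_{I_𝔓}` has no stable line at every `𝔓 ∣ p`;
  **`SubGss.sub_one_dvd_card_inertia_map_and_not_dvd`** — if moreover `p ∤ e_p` then
  `(p − 1) ∣ e_p` and `e_p ∤ p − 1`; and the O8 forms **`O8.not_exists_inertia_stableLine_of_subGss`**,
  **`O8.sub_one_dvd_card_inertia_map_and_not_dvd_of_subGss`** (`ClassX4 W p`, `¬ Surj W p`,
  `SubGss W p`: niveau 2, `(p − 1) ∣ e_p ∤ p − 1` — at `p = 3` this is `e₃ = 8`, GEN 8).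

So the O8 sub-partition by `e_p` is now THEOREM-LEVEL on all three tame cells at every odd `p`:
(M) and (G-ord) ⟹ niveau 1, `e_p = p − 1` (GEN 7–9); `(G) ∧ ss` ⟹ niveau 2, `e_p ∤ p − 1` (here).
NOT claimed: the exact value of `e_p` on `(G) ∧ ss` rows of `E` itself (it is `p² − 1` or
`2(p² − 1)` according as `χ_{p*}|_{I}` lies in the image; not needed); anything at `p = 2`; anything
on the (t′) / wild rows; any class theorem of BSD type; no label moves.

References: [Serre1972] J.-P. Serre, Invent. Math. 15 (1972) §1.3 Prop. 1–2, §1.11 Prop. 12;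
[SilvermanAEC2009] *AEC* X.5 Cor. 5.4, VII.5.4; [Edixhoven1997Serre] B. Edixhoven, in
Cornell–Silverman–Stevens (1997) §4.2 (PDF p. 297–298: fundamental characters of level 1 and 2);
[NeukirchANT1999] Ch. I §9 (9.1), (9.4) (conjugate primes and inertia groups);
[Delbourgo1998] §1.5 hypothesis (G).
-/

set_option autoImplicit false

noncomputable section

open scoped Classical NumberField Pointwise

open Field IsDedekindDomain NumberField WeierstrassCurve
  Literature.NumberTheory.EllipticCurves Literature.NumberTheory.GaloisRepresentations
  Literature.NumberTheory.EllipticCurves.Rank1Residual Rat.HeightOneSpectrum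
  Summit.BirchSwinnertonDyer.Rank1Residual.Additive

namespace Summit.BirchSwinnertonDyer.Rank1Residual.GaloisImage

/-! ## §1. Transport of stable lines: signed isomorphisms and conjugate primes -/

section Transport

variable {W₁ W₂ : WeierstrassCurve ℚ} {p : ℕ}

/-- The inverse of an isomorphism `t : W₁[p] ≃+ W₂[p]` that is `Γ_ℚ`-equivariant up to a
`σ`-dependent sign is again equivariant up to the same sign. [folklore] -/
theorem signed_addEquiv_symm (t : geomTorsion W₁ (p : ℤ) ≃+ geomTorsion W₂ (p : ℤ))
    (ht : ∀ σ : absoluteGaloisGroup ℚ,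
      (∀ x, t (σ • x) = σ • t x) ∨ (∀ x, t (σ • x) = -(σ • t x))) :
    ∀ σ : absoluteGaloisGroup ℚ,
      (∀ y, t.symm (σ • y) = σ • t.symm y) ∨ (∀ y, t.symm (σ • y) = -(σ • t.symm y)) := by
  intro σ
  rcases ht σ with h | h
  · refine Or.inl fun y ↦ t.injective ?_
    rw [t.apply_symm_apply, h, t.apply_symm_apply]
  · refine Or.inr fun y ↦ t.injective ?_
    rw [t.apply_symm_apply, map_neg, h, t.apply_symm_apply, neg_neg]

/-- **Stable lines move along a signed isomorphism.** If `t : W₁[p] ≃+ W₂[p]` is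
`Γ_ℚ`-equivariant up to a `σ`-dependent sign and `L ⊂ W₁[p]` is a line (order `p`) stable under a
subgroup `H ≤ Γ_ℚ`, then `t(L)` is an `H`-stable line of `W₂[p]` (a subgroup is closed under `−1`).
[cite: SilvermanAEC2009, X.5 Cor. 5.4] -/
theorem exists_stableLine_of_signed_addEquiv (H : Subgroup (absoluteGaloisGroup ℚ))
    (t : geomTorsion W₁ (p : ℤ) ≃+ geomTorsion W₂ (p : ℤ))
    (ht : ∀ σ : absoluteGaloisGroup ℚ,
      (∀ x, t (σ • x) = σ • t x) ∨ (∀ x, t (σ • x) = -(σ • t x)))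
    (hL : ∃ L : AddSubgroup (geomTorsion W₁ (p : ℤ)), Nat.card L = p ∧
      ∀ σ ∈ H, ∀ P ∈ L, σ • P ∈ L) :
    ∃ L : AddSubgroup (geomTorsion W₂ (p : ℤ)), Nat.card L = p ∧
      ∀ σ ∈ H, ∀ P ∈ L, σ • P ∈ L := by
  obtain ⟨L, hcard, hstab⟩ := hL
  refine ⟨L.map t.toAddMonoidHom, ?_, ?_⟩
  · exact (Nat.card_congr (L.equivMapOfInjective t.toAddMonoidHom t.injective).toEquiv).symm.trans
      hcard
  · rintro σ hσ _ ⟨x, hx, rfl⟩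
    rcases ht σ with h | h
    · exact ⟨σ • x, hstab σ hσ x hx, by simp [h]⟩
    · exact ⟨-(σ • x), neg_mem (hstab σ hσ x hx), by simp [map_neg, h]⟩

/-- Having an `H`-stable line is INVARIANT along a signed isomorphism `W₁[p] ≃+ W₂[p]`.
[cite: SilvermanAEC2009, X.5 Cor. 5.4] -/
theorem exists_stableLine_iff_of_signed_addEquiv (H : Subgroup (absoluteGaloisGroup ℚ))
    (t : geomTorsion W₁ (p : ℤ) ≃+ geomTorsion W₂ (p : ℤ))
    (ht : ∀ σ : absoluteGaloisGroup ℚ,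
      (∀ x, t (σ • x) = σ • t x) ∨ (∀ x, t (σ • x) = -(σ • t x))) :
    (∃ L : AddSubgroup (geomTorsion W₁ (p : ℤ)), Nat.card L = p ∧
        ∀ σ ∈ H, ∀ P ∈ L, σ • P ∈ L) ↔
      ∃ L : AddSubgroup (geomTorsion W₂ (p : ℤ)), Nat.card L = p ∧
        ∀ σ ∈ H, ∀ P ∈ L, σ • P ∈ L :=
  ⟨exists_stableLine_of_signed_addEquiv H t ht,
    exists_stableLine_of_signed_addEquiv H t.symm (signed_addEquiv_symm t ht)⟩

variable {W : WeierstrassCurve ℚ}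

/-- **Stable lines move to conjugate primes**: an `I_𝔓`-stable line `L ⊂ E[p]` gives the
`I_{g𝔓}`-stable line `g L` (`I_{g𝔓} = g I_𝔓 g⁻¹`). [cite: NeukirchANT1999, Ch. I §9 (9.4)] -/
theorem exists_stableLine_inertia_smul (𝔓 : Ideal (absIntegers (𝓞 ℚ) ℚ))
    (g : absoluteGaloisGroup ℚ)
    (hL : ∃ L : AddSubgroup (geomTorsion W (p : ℤ)), Nat.card L = p ∧
      ∀ σ ∈ 𝔓.inertia (absoluteGaloisGroup ℚ), ∀ P ∈ L, σ • P ∈ L) :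
    ∃ L : AddSubgroup (geomTorsion W (p : ℤ)), Nat.card L = p ∧
      ∀ σ ∈ (g • 𝔓).inertia (absoluteGaloisGroup ℚ), ∀ P ∈ L, σ • P ∈ L := by
  obtain ⟨L, hcard, hstab⟩ := hL
  let f : geomTorsion W (p : ℤ) →+ geomTorsion W (p : ℤ) :=
    DistribSMul.toAddMonoidHom (geomTorsion W (p : ℤ)) g
  have hfinj : Function.Injective f := fun x y (h : g • x = g • y) ↦ MulAction.injective g h
  refine ⟨L.map f, ?_, ?_⟩
  · exact (Nat.card_congr (L.equivMapOfInjective f hfinj).toEquiv).symm.trans hcard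
  · rintro σ hσ _ ⟨x, hx, rfl⟩
    have hσ' : g⁻¹ * σ * g ∈ 𝔓.inertia (absoluteGaloisGroup ℚ) := by
      rw [← Ideal.conj_mem_inertia_smul_iff 𝔓 g]
      simpa [mul_assoc] using hσ
    refine ⟨(g⁻¹ * σ * g) • x, hstab _ hσ' x hx, ?_⟩
    show g • ((g⁻¹ * σ * g) • x) = σ • (g • x)
    rw [mul_smul, mul_smul, smul_inv_smul]

/-- **"No `I_𝔓`-stable line" at one prime above `p` gives it at every prime above `p`**
(`Γ_ℚ` is transitive on the primes of `ℤ̄` above `p`: `exists_smul_eq_of_mem_primesAbove_holds`).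
[cite: NeukirchANT1999, Ch. I §9 Prop. (9.1) and (9.4)] -/
theorem not_exists_stableLine_of_mem_primesAbove {v : HeightOneSpectrum (𝓞 ℚ)}
    {𝔓 𝔓' : Ideal (absIntegers (𝓞 ℚ) ℚ)} (h𝔓 : 𝔓 ∈ v.primesAbove) (h𝔓' : 𝔓' ∈ v.primesAbove)
    (hno : ¬ ∃ L : AddSubgroup (geomTorsion W (p : ℤ)), Nat.card L = p ∧
      ∀ σ ∈ 𝔓.inertia (absoluteGaloisGroup ℚ), ∀ P ∈ L, σ • P ∈ L) :
    ¬ ∃ L : AddSubgroup (geomTorsion W (p : ℤ)), Nat.card L = p ∧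
      ∀ σ ∈ 𝔓'.inertia (absoluteGaloisGroup ℚ), ∀ P ∈ L, σ • P ∈ L := by
  intro hL
  obtain ⟨g, hg⟩ :=
    HeightOneSpectrum.exists_smul_eq_of_mem_primesAbove_holds (K := ℚ) (v := v) h𝔓' h𝔓
  exact hno (hg ▸ exists_stableLine_inertia_smul 𝔓' g hL)

end Transport

/-! ## §2. Serre 1972 §1.11 Prop. 12, LOCAL form: good supersingular ⟹ niveau 2 at every `𝔓 ∣ p` -/

section Supersingular

variable {W : WeierstrassCurve ℚ} [W.IsElliptic] [W.IsGloballyMinimal] {p : ℕ} [hp : Fact p.Prime]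

/-- `p ∤ p² − 1` and `p² − 1 ∤ p − 1` for a prime `p`. [folklore] -/
theorem not_dvd_sq_sub_one_and : ¬ p ∣ p ^ 2 - 1 ∧ ¬ p ^ 2 - 1 ∣ p - 1 := by
  have hp' : p.Prime := hp.out
  have h1 : 1 < p ^ 2 := Nat.one_lt_pow two_ne_zero hp'.one_lt
  have h2 := hp'.two_le
  refine ⟨fun h ↦ ?_, fun h ↦ ?_⟩
  · have h3 : p ∣ (p ^ 2 - 1) + 1 := by
      rw [Nat.sub_add_cancel h1.le]; exact dvd_pow_self p two_ne_zero
    exact hp'.one_lt.ne' (Nat.dvd_one.mp ((Nat.dvd_add_right h).mp h3))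
  · have h3 := Nat.le_of_dvd (by omega) h
    have h4 : 2 * p ≤ p ^ 2 := by nlinarith
    generalize p ^ 2 = q at *
    omega

/-- **At an odd prime of good SUPERSINGULAR reduction `E[p]|_{I_𝔓}` has NO stable line (niveau 2),
at EVERY prime `𝔓` of `ℤ̄` above `p`** (Serre 1972 §1.11 Prop. 12, local form). For `W/ℚ` globally
minimal elliptic, `p ≠ 2`, `GoodSS W p` (`good(p)`, `p ∣ a_p`). At the place's prime the inertia
image is cyclic of order `p² − 1` (`isCyclic_and_card_inertia_map_of_dvd_frobeniusTrace`, tame Kummer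
input `exists_mem_inertia_smul_eq_mul_of_pow_eq`), `p ∤ p² − 1 ∤ p − 1`, so GEN 9's
`not_exists_stableLine_iff_not_card_inertia_map_dvd_sub_one` gives no stable line there; §1 moves
this to every `𝔓 ∣ p`. [cite: Serre1972, §1.11 Prop. 12 and §1.3 Prop. 1–2]
[cite: Edixhoven1997Serre, §4.2 (PDF p. 297)] -/
theorem not_exists_inertia_stableLine_of_goodSS (hp2 : p ≠ 2) (hss : GoodSS W p)
    {v : HeightOneSpectrum (𝓞 ℚ)} (hv : ((p : ℕ) : 𝓞 ℚ) ∈ v.asIdeal)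
    {𝔓 : Ideal (absIntegers (𝓞 ℚ) ℚ)} (h𝔓 : 𝔓 ∈ v.primesAbove) :
    ¬ ∃ L : AddSubgroup (geomTorsion W (p : ℤ)), Nat.card L = p ∧
      ∀ σ ∈ 𝔓.inertia (absoluteGaloisGroup ℚ), ∀ P ∈ L, σ • P ∈ L := by
  have hp' : p.Prime := hp.out
  have hveq : v = primesEquiv.symm ⟨p, hp'⟩ :=
    (natCast_mem_asIdeal_iff_eq_primesEquiv_symm v hp').mp hv
  have hvp : (primesEquiv v : ℕ) = p := by rw [hveq, Equiv.apply_symm_apply]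
  obtain ⟨𝔓₀, hmem₀, h𝔓₀⟩ := exists_ideal_placeOver p hvp
  refine not_exists_stableLine_of_mem_primesAbove h𝔓₀ h𝔓 ?_
  have hΔ : ¬ (p : ℤ) ∣ minimalDiscriminantInt W :=
    W.not_dvd_minimalDiscriminantInt_of_hasGoodReductionAtPrime' p hss.1
  have hT : ∀ π ζ : AlgebraicClosure ℚ, π ^ (p ^ 2 - 1) = p → ζ ^ (p ^ 2 - 1) = 1 →
      ∃ s ∈ 𝔓₀.inertia (absoluteGaloisGroup ℚ), s • π = ζ * π := fun π ζ hπ hζ ↦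
    exists_mem_inertia_smul_eq_mul_of_pow_eq p
      (Nat.sub_pos_of_lt (Nat.one_lt_pow two_ne_zero hp'.one_lt)) hvp h𝔓₀ hπ hζ
  obtain ⟨-, hcard⟩ :=
    isCyclic_and_card_inertia_map_of_dvd_frobeniusTrace p hΔ hss.2 hp2 hmem₀ hT
  obtain ⟨hnd, hnd'⟩ := not_dvd_sq_sub_one_and (p := p)
  have hI : ¬ p ∣ Nat.card ((𝔓₀.inertia (absoluteGaloisGroup ℚ)).map (galoisRepTorsion W p)) := by
    rw [hcard]; exact hnd
  refine (not_exists_stableLine_iff_not_card_inertia_map_dvd_sub_one hv h𝔓₀ hI).mpr ?_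
  rw [hcard]; exact hnd'

end Supersingular

/-! ## §3. Quadratic twists: niveau is a twist invariant; a good supersingular twist ⟹ niveau 2 -/

section Twist

variable (W : WeierstrassCurve ℚ) (p : ℕ) [hp : Fact p.Prime]

omit hp in
/-- **Having an `I_𝔓`-stable line in `E[p]` is a quadratic-twist invariant** (any `d ≠ 0`, any
`ℚ`-model `Wd` of `E^{(d)}`, any subgroup `H ≤ Γ_ℚ`): the twisting isomorphism `E[p] ≃+ E^{(d)}[p]`
is `Γ_ℚ`-equivariant up to the sign `χ_d(σ)` (`exists_torsion_addEquiv_signed_of_model_twist`).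
[cite: SilvermanAEC2009, X.5 Cor. 5.4] -/
theorem exists_inertia_stableLine_iff_of_twist {d : ℚ} (hd : d ≠ 0) (Wd : WeierstrassCurve ℚ)
    (hWd : ∃ C : VariableChange ℚ, C • W.quadraticTwist d = Wd)
    (H : Subgroup (absoluteGaloisGroup ℚ)) :
    (∃ L : AddSubgroup (geomTorsion W (p : ℤ)), Nat.card L = p ∧
        ∀ σ ∈ H, ∀ P ∈ L, σ • P ∈ L) ↔
      ∃ L : AddSubgroup (geomTorsion Wd (p : ℤ)), Nat.card L = p ∧
        ∀ σ ∈ H, ∀ P ∈ L, σ • P ∈ L := by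
  obtain ⟨t, ht⟩ := exists_torsion_addEquiv_signed_of_model_twist W p Wd hd hWd
  exact exists_stableLine_iff_of_signed_addEquiv H t ht

/-- **A good SUPERSINGULAR quadratic twist at an odd `p` ⟹ `E[p]|_{I_𝔓}` has NO stable line, at
every `𝔓 ∣ p`** (niveau 2). Hypotheses: `C • W.quadraticTwist d = Wd` for some `C`, `d ≠ 0`, `Wd`
globally minimal with `GoodSS Wd p`, `p ≠ 2`. (§2 for `Wd`, transported by the invariance above.)
This is the local shape "`ρ̄|_{I_p}` irreducible" of the `(G) ∧ ss`, `e = 2` rows (`E = V ⊗ χ_{p*}`,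
`V` good supersingular). [cite: Serre1972, §1.11 Prop. 12] [cite: SilvermanAEC2009, X.5 Cor. 5.4] -/
theorem not_exists_inertia_stableLine_of_goodSS_twist (hp2 : p ≠ 2) {d : ℚ} (hd : d ≠ 0)
    (Wd : WeierstrassCurve ℚ) [Wd.IsElliptic] [Wd.IsGloballyMinimal]
    (hWd : ∃ C : VariableChange ℚ, C • W.quadraticTwist d = Wd) (hss : GoodSS Wd p)
    {v : HeightOneSpectrum (𝓞 ℚ)} (hv : ((p : ℕ) : 𝓞 ℚ) ∈ v.asIdeal)
    {𝔓 : Ideal (absIntegers (𝓞 ℚ) ℚ)} (h𝔓 : 𝔓 ∈ v.primesAbove) :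
    ¬ ∃ L : AddSubgroup (geomTorsion W (p : ℤ)), Nat.card L = p ∧
      ∀ σ ∈ 𝔓.inertia (absoluteGaloisGroup ℚ), ∀ P ∈ L, σ • P ∈ L := fun hL ↦
  not_exists_inertia_stableLine_of_goodSS hp2 hss hv h𝔓
    ((exists_inertia_stableLine_iff_of_twist W p hd Wd hWd _).mp hL)

variable {W p}
variable [W.IsElliptic]

/-- **Good supersingular twist, tame row ⟹ `(p − 1) ∣ e_p` and `e_p ∤ p − 1`** (`e_p =
#ρ̄_{E,p}(I_𝔓)`, any `𝔓 ∣ p`): the niveau-1 branch of GEN 9's dichotomy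
`card_inertia_map_eq_sub_one_or_not_dvd_sub_one` would give a stable line, excluded above.
[cite: Serre1972, §1.3 and §1.11 Prop. 12] -/
theorem sub_one_dvd_card_inertia_map_and_not_dvd_of_goodSS_twist (hp2 : p ≠ 2) {d : ℚ}
    (hd : d ≠ 0) (Wd : WeierstrassCurve ℚ) [Wd.IsElliptic] [Wd.IsGloballyMinimal]
    (hWd : ∃ C : VariableChange ℚ, C • W.quadraticTwist d = Wd) (hss : GoodSS Wd p)
    {v : HeightOneSpectrum (𝓞 ℚ)} (hv : ((p : ℕ) : 𝓞 ℚ) ∈ v.asIdeal)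
    {𝔓 : Ideal (absIntegers (𝓞 ℚ) ℚ)} (h𝔓 : 𝔓 ∈ v.primesAbove)
    (hI : ¬ p ∣ Nat.card ((𝔓.inertia (absoluteGaloisGroup ℚ)).map (galoisRepTorsion W p))) :
    (p - 1) ∣ Nat.card ((𝔓.inertia (absoluteGaloisGroup ℚ)).map (galoisRepTorsion W p)) ∧
      ¬ Nat.card ((𝔓.inertia (absoluteGaloisGroup ℚ)).map (galoisRepTorsion W p)) ∣ p - 1 := by
  rcases card_inertia_map_eq_sub_one_or_not_dvd_sub_one hv h𝔓 hI with
    ⟨-, X, -, hX, -, -, -, hXs, -⟩ | ⟨h1, h2, -⟩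
  · exact absurd ⟨X, hX, hXs⟩
      (not_exists_inertia_stableLine_of_goodSS_twist W p hp2 hd Wd hWd hss hv h𝔓)
  · exact ⟨h1, h2⟩

end Twist

/-! ## §4. The census cell `(G) ∧ ss` and the O8 rows -/

section Cell

variable (W : WeierstrassCurve ℚ) [W.IsElliptic] [W.IsGloballyMinimal] (p : ℕ) [hp : Fact p.Prime]

/-- **`(G) ∧ ss` ⟹ niveau 2 at every `𝔓 ∣ p`** (`p` odd, `E` additive at `p`): on cc-typer-5's
census cell `SubGss W p` (Delbourgo's (G), potentially good SUPERSINGULAR; Kodaira `I₀*`, `e = 2`)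
`E[p]|_{I_𝔓}` has no stable line. The twist datum is SUPPLIED by
`O5.exists_goodSS_twist_pStar_of_subGss` (`E^{(p*)}` is good supersingular at `p`).
[cite: Serre1972, §1.11 Prop. 12] [cite: Delbourgo1998, §1.5 (G)] [cite: SilvermanAEC2009, X.5 Cor. 5.4] -/
theorem SubGss.not_exists_inertia_stableLine (hp2 : p ≠ 2) (hadd : Addv W p) (hG : SubGss W p)
    {v : HeightOneSpectrum (𝓞 ℚ)} (hv : ((p : ℕ) : 𝓞 ℚ) ∈ v.asIdeal)
    {𝔓 : Ideal (absIntegers (𝓞 ℚ) ℚ)} (h𝔓 : 𝔓 ∈ v.primesAbove) :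
    ¬ ∃ L : AddSubgroup (geomTorsion W (p : ℤ)), Nat.card L = p ∧
      ∀ σ ∈ 𝔓.inertia (absoluteGaloisGroup ℚ), ∀ P ∈ L, σ • P ∈ L := by
  obtain ⟨Wd, hE, hM, C, hC, hss⟩ := O5.exists_goodSS_twist_pStar_of_subGss W p hp2 hadd hG
  exact not_exists_inertia_stableLine_of_goodSS_twist W p hp2 (O5.pStar_ne_zero p) Wd ⟨C, hC⟩
    hss hv h𝔓

/-- **`(G) ∧ ss`, tame row ⟹ `(p − 1) ∣ e_p ∤ p − 1`** (`p` odd, `E` additive at `p`, `p ∤ e_p`).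
[cite: Serre1972, §1.3 and §1.11 Prop. 12] [cite: Delbourgo1998, §1.5 (G)] -/
theorem SubGss.sub_one_dvd_card_inertia_map_and_not_dvd (hp2 : p ≠ 2) (hadd : Addv W p)
    (hG : SubGss W p) {v : HeightOneSpectrum (𝓞 ℚ)} (hv : ((p : ℕ) : 𝓞 ℚ) ∈ v.asIdeal)
    {𝔓 : Ideal (absIntegers (𝓞 ℚ) ℚ)} (h𝔓 : 𝔓 ∈ v.primesAbove)
    (hI : ¬ p ∣ Nat.card ((𝔓.inertia (absoluteGaloisGroup ℚ)).map (galoisRepTorsion W p))) :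
    (p - 1) ∣ Nat.card ((𝔓.inertia (absoluteGaloisGroup ℚ)).map (galoisRepTorsion W p)) ∧
      ¬ Nat.card ((𝔓.inertia (absoluteGaloisGroup ℚ)).map (galoisRepTorsion W p)) ∣ p - 1 := by
  obtain ⟨Wd, hE, hM, C, hC, hss⟩ := O5.exists_goodSS_twist_pStar_of_subGss W p hp2 hadd hG
  exact sub_one_dvd_card_inertia_map_and_not_dvd_of_goodSS_twist hp2 (O5.pStar_ne_zero p) Wd
    ⟨C, hC⟩ hss hv h𝔓 hI

/-- **O8 ∩ (G) ∧ ss: niveau 2 at every `𝔓 ∣ p`** — on an O8 row (`ClassX4 W p`: `p` odd, additive,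
`E[p]` irreducible) in the census cell `(G) ∧ ss`, `E[p]|_{I_𝔓}` has NO stable line (no `¬ Surj`
needed). With GEN 7–9 ((M), (G-ord) ⟹ niveau 1) the O8 sub-partition by niveau is theorem-level on
all three tame cells. [cite: Serre1972, §1.11 Prop. 12] [cite: Delbourgo1998, §1.5 (G)] -/
theorem O8.not_exists_inertia_stableLine_of_subGss (hX : ClassX4 W p) (hG : SubGss W p)
    {v : HeightOneSpectrum (𝓞 ℚ)} (hv : ((p : ℕ) : 𝓞 ℚ) ∈ v.asIdeal)
    {𝔓 : Ideal (absIntegers (𝓞 ℚ) ℚ)} (h𝔓 : 𝔓 ∈ v.primesAbove) :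
    ¬ ∃ L : AddSubgroup (geomTorsion W (p : ℤ)), Nat.card L = p ∧
      ∀ σ ∈ 𝔓.inertia (absoluteGaloisGroup ℚ), ∀ P ∈ L, σ • P ∈ L :=
  SubGss.not_exists_inertia_stableLine W p hX.1 hX.2.1 hG hv h𝔓

/-- **O8 ∩ (G) ∧ ss: `(p − 1) ∣ e_p` and `e_p ∤ p − 1`** at every `𝔓 ∣ p` (`ClassX4 W p`,
`¬ Surj W p` ⟹ `p ∤ e_p` by GEN 7's `Additive.O8.not_dvd_card_inertia_map_galoisRepTorsion`).
At `p = 3`: `e₃ = 8` (GEN 8). [cite: Serre1972, §1.3, §1.11 Prop. 12 and §2.4 Prop. 15] -/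
theorem O8.sub_one_dvd_card_inertia_map_and_not_dvd_of_subGss (hX : ClassX4 W p) (hns : ¬ Surj W p)
    (hG : SubGss W p) {v : HeightOneSpectrum (𝓞 ℚ)} (hv : ((p : ℕ) : 𝓞 ℚ) ∈ v.asIdeal)
    {𝔓 : Ideal (absIntegers (𝓞 ℚ) ℚ)} (h𝔓 : 𝔓 ∈ v.primesAbove) :
    (p - 1) ∣ Nat.card ((𝔓.inertia (absoluteGaloisGroup ℚ)).map (galoisRepTorsion W p)) ∧
      ¬ Nat.card ((𝔓.inertia (absoluteGaloisGroup ℚ)).map (galoisRepTorsion W p)) ∣ p - 1 :=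
  SubGss.sub_one_dvd_card_inertia_map_and_not_dvd W p hX.1 hX.2.1 hG hv h𝔓
    (Additive.O8.not_dvd_card_inertia_map_galoisRepTorsion W p hX hns 𝔓)

/-- **O8: the niveau DECIDES the cell among the tame cells** — on an O8 row with `¬ Surj W p` in
`(G) ∧ ss` there is NO `I_𝔓`-stable pair either, so `e_p ≠ p − 1` (contrast GEN 9's
`O8.card_inertia_map_eq_sub_one_of_twistedOrdinaryLineAt` on (M)/(G-ord): `e_p = p − 1`).
[cite: Serre1972, §1.3 and §1.11] -/
theorem O8.card_inertia_map_ne_sub_one_of_subGss (hX : ClassX4 W p) (hns : ¬ Surj W p)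
    (hG : SubGss W p) {v : HeightOneSpectrum (𝓞 ℚ)} (hv : ((p : ℕ) : 𝓞 ℚ) ∈ v.asIdeal)
    {𝔓 : Ideal (absIntegers (𝓞 ℚ) ℚ)} (h𝔓 : 𝔓 ∈ v.primesAbove) :
    Nat.card ((𝔓.inertia (absoluteGaloisGroup ℚ)).map (galoisRepTorsion W p)) ≠ p - 1 := by
  intro h
  exact (O8.sub_one_dvd_card_inertia_map_and_not_dvd_of_subGss W p hX hns hG hv h𝔓).2
    (h ▸ dvd_rfl)

end Cell

end Summit.BirchSwinnertonDyer.Rank1Residual.GaloisImage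

end
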